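import Summits.CriticalPhenomena.CardyFormulaZ2.Theorems.CardyBoundaryCoulombGasRectilinearCardyStubBoundaryFeetPart8
import Summits.CriticalPhenomena.CardyFormulaZ2.Theorems.CardyBoundaryCoulombGasRectilinearCardyStubRowBlocksPart2
import HarnessLib

/-!
# Stub `stub_boundaryFeet` of line `excursion-kernel-covariance` — Part 9:
# neighbour counts and lattice convex corners inside a frame chart
# (crux `RectilinearCardy`, stmt-CriticalPhenomena-5660)

Pure `ℤ²` combinatorics inside the frame chart of Part 3 (`bft_frame_chart`): on the frame box of
radius `2` about a vertex `u`, membership in `V` is the sector predicate of type `m ∈ {1, 2, 3}`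
(quadrant `X ≤ al ∧ Y ≤ pe`, half-plane `Y ≤ pe`, co-quadrant `Y ≤ pe ∨ al ≤ X`) of the frame
coordinates `al = ⟨·, dir K⟩`, `pe = ⟨·, dir (K+1)⟩`.

* `bft_frame_step` — frame coordinates of the four lattice steps from a frame point;
* `bft_card_le_two` — a vertex of `V` carrying the chart has at most two outside neighbours
  (the step along `dir (K+1)` and one of the steps along `± dir K` always stay inside);
* `bft_corner_local` — if two CONSECUTIVE directions `k, k + 1` at `u ∈ V` point outside, then
  the chart is a quadrant with corner `u`, `k = K + 2`, and the boundary walk enters the corner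
  straight from the row neighbour `u + dir (k + 3)` and leaves it straight through the row
  neighbour `u + dir (k + 2)`, both of which have exactly one outside neighbour:
  `dsucc V (u + dir (k+3), k) = (u, k)`, `dsucc V (u, k+1) = (u + dir (k+2), k+1)`.
These are the last two clauses of the boundary-feet theorem, read locally. All [folklore].
-/

noncomputable section

open Set
open Literature.Probability.RandomPlanarGeometry
open Literature.Probability.LatticeModels Literature.Probability.LatticeModels.CollarLegModel
open Summit.CriticalPhenomena.CardyFormulaZ2.Cruxes.BoundaryDefectGaussianR.RainbowMonomialsInExcursionKernels

namespace Summit.CriticalPhenomena.CardyFormulaZ2.Cruxes.RectilinearCardy.ExcursionKernelCovariance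

/-- Frame coordinates of the four lattice steps from the frame point `u + s • dir K + t • dir (K+1)`.
[folklore] -/
theorem bft_frame_step (K : Fin 4) (u : ℤ × ℤ) (s t : ℤ) :
    u + s • dir K + t • dir (K + 1) + dir (K + 0) = u + (s + 1) • dir K + t • dir (K + 1) ∧
    u + s • dir K + t • dir (K + 1) + dir (K + 1) = u + s • dir K + (t + 1) • dir (K + 1) ∧
    u + s • dir K + t • dir (K + 1) + dir (K + 2) = u + (s - 1) • dir K + t • dir (K + 1) ∧
    u + s • dir K + t • dir (K + 1) + dir (K + 3) = u + s • dir K + (t - 1) • dir (K + 1) := by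
  rw [add_zero, tp_dir_add_two, tp_dir_add_three]
  refine ⟨?_, ?_, ?_, ?_⟩ <;> module

/-- Small `Fin 4` facts about two consecutive directions in a frame. [folklore] -/
theorem bft_fin_consec (K k : Fin 4) :
    (k = K + 0 → k + 1 = K + 1) ∧ (k = K + 1 → k + 1 = K + 2) ∧ (k = K + 2 → k + 1 = K + 3) ∧
    (k = K + 3 → k + 1 = K + 0) := by
  revert K k; decide

/-- Small `Fin 4` facts about the directions at a frame corner. [folklore] -/
theorem bft_fin_corner (K : Fin 4) :
    K + 2 + 1 = K + 3 ∧ K + 3 + 1 = K + 0 ∧ K + 2 + 2 = K + 0 ∧ K + 2 + 3 = K + 1 := by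
  revert K; decide

/-- **At most two outside neighbours** at a vertex of `V` carrying a frame chart. [folklore] -/
theorem bft_card_le_two (V : Finset (ℤ × ℤ)) {m : ℕ} (hm : m = 1 ∨ m = 2 ∨ m = 3) (K : Fin 4) (X Y : ℤ)
    (u : ℤ × ℤ)
    (hch : ∀ s t : ℤ, -2 ≤ s → s ≤ 2 → -2 ≤ t → t ≤ 2 →
      (u + s • dir K + t • dir (K + 1) ∈ V ↔
        ((m = 1 → X ≤ u.1 * (dir K).1 + u.2 * (dir K).2 + s ∧
            Y ≤ u.1 * (dir (K + 1)).1 + u.2 * (dir (K + 1)).2 + t) ∧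
          (m = 2 → Y ≤ u.1 * (dir (K + 1)).1 + u.2 * (dir (K + 1)).2 + t) ∧
          (m = 3 → Y ≤ u.1 * (dir (K + 1)).1 + u.2 * (dir (K + 1)).2 + t ∨
            u.1 * (dir K).1 + u.2 * (dir K).2 + s ≤ X))))
    (hu : u ∈ V) :
    ((neighbours u).filter (fun y ↦ y ∉ V)).card ≤ 2 := by
  classical
  obtain ⟨e0, e1, e2, e3⟩ := bft_step_frame K u
  have h00 := (hch 0 0 (by norm_num) (by norm_num) (by norm_num) (by norm_num)).1 (by simpa using hu)
  -- the step along `dir (K+1)` stays inside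
  have hin1 : u + dir (K + 1) ∈ V := by
    rw [e1, hch 0 1 (by norm_num) (by norm_num) (by norm_num) (by norm_num)]
    rcases hm with rfl | rfl | rfl
    · rw [bft_mem_one] at h00 ⊢; omega
    · rw [bft_mem_two] at h00 ⊢; omega
    · rw [bft_mem_three] at h00 ⊢; omega
  -- one of the steps along `± dir K` stays inside
  have hin2 : u + dir (K + 0) ∈ V ∨ u + dir (K + 2) ∈ V := by
    rw [e0, e2, hch 1 0 (by norm_num) (by norm_num) (by norm_num) (by norm_num),
      hch (-1) 0 (by norm_num) (by norm_num) (by norm_num) (by norm_num)]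
    rcases hm with rfl | rfl | rfl
    · rw [bft_mem_one] at h00; rw [bft_mem_one, bft_mem_one]; omega
    · rw [bft_mem_two] at h00; rw [bft_mem_two, bft_mem_two]; omega
    · rw [bft_mem_three] at h00; rw [bft_mem_three, bft_mem_three]; omega
  rw [rb_card_filter_dir]
  rcases hin2 with hin2 | hin2
  · calc ((Finset.univ : Finset (Fin 4)).filter (fun j ↦ u + dir j ∉ V)).card
          ≤ ({K + 2, K + 3} : Finset (Fin 4)).card := by
            refine Finset.card_le_card fun j hj => ?_
            rw [Finset.mem_filter] at hj
            rw [Finset.mem_insert, Finset.mem_singleton]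
            rcases bft_dir_cases K j with rfl | rfl | rfl | rfl
            · exact absurd hin2 hj.2
            · exact absurd hin1 hj.2
            · exact Or.inl rfl
            · exact Or.inr rfl
      _ ≤ 2 := Finset.card_le_two
  · calc ((Finset.univ : Finset (Fin 4)).filter (fun j ↦ u + dir j ∉ V)).card
          ≤ ({K + 0, K + 3} : Finset (Fin 4)).card := by
            refine Finset.card_le_card fun j hj => ?_
            rw [Finset.mem_filter] at hj
            rw [Finset.mem_insert, Finset.mem_singleton]
            rcases bft_dir_cases K j with rfl | rfl | rfl | rfl
            · exact Or.inl rfl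
            · exact absurd hin1 hj.2
            · exact absurd hin2 hj.2
            · exact Or.inr rfl
      _ ≤ 2 := Finset.card_le_two

/-- **A lattice convex corner inside a frame chart, and how the boundary walk passes it.** See the
module docstring. [folklore] -/
theorem bft_corner_local (V : Finset (ℤ × ℤ)) {m : ℕ} (hm : m = 1 ∨ m = 2 ∨ m = 3) (K : Fin 4) (X Y : ℤ)
    (u : ℤ × ℤ)
    (hch : ∀ s t : ℤ, -2 ≤ s → s ≤ 2 → -2 ≤ t → t ≤ 2 →
      (u + s • dir K + t • dir (K + 1) ∈ V ↔
        ((m = 1 → X ≤ u.1 * (dir K).1 + u.2 * (dir K).2 + s ∧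
            Y ≤ u.1 * (dir (K + 1)).1 + u.2 * (dir (K + 1)).2 + t) ∧
          (m = 2 → Y ≤ u.1 * (dir (K + 1)).1 + u.2 * (dir (K + 1)).2 + t) ∧
          (m = 3 → Y ≤ u.1 * (dir (K + 1)).1 + u.2 * (dir (K + 1)).2 + t ∨
            u.1 * (dir K).1 + u.2 * (dir K).2 + s ≤ X))))
    (hu : u ∈ V) {k : Fin 4} (hk : u + dir k ∉ V) (hk1 : u + dir (k + 1) ∉ V) :
    u + dir (k + 3) ∈ V ∧ u + dir (k + 3) + dir k ∉ V ∧
    dsucc V (u + dir (k + 3), k) = (u, k) ∧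
    dsucc V (u, k + 1) = (u + dir (k + 2), k + 1) ∧
    ((neighbours (u + dir (k + 3))).filter (fun y ↦ y ∉ V)).card = 1 ∧
    ((neighbours (u + dir (k + 2))).filter (fun y ↦ y ∉ V)).card = 1 := by
  obtain ⟨e0, e1, e2, e3⟩ := bft_step_frame K u
  obtain ⟨c0, c1, c2, c3⟩ := bft_fin_consec K k
  -- membership of the frame points we need, as arithmetic in the frame coordinates
  have P : ∀ s t : ℤ, -2 ≤ s → s ≤ 2 → -2 ≤ t → t ≤ 2 →
      (u + s • dir K + t • dir (K + 1) ∈ V ↔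
        ((m = 1 → X ≤ u.1 * (dir K).1 + u.2 * (dir K).2 + s ∧
            Y ≤ u.1 * (dir (K + 1)).1 + u.2 * (dir (K + 1)).2 + t) ∧
          (m = 2 → Y ≤ u.1 * (dir (K + 1)).1 + u.2 * (dir (K + 1)).2 + t) ∧
          (m = 3 → Y ≤ u.1 * (dir (K + 1)).1 + u.2 * (dir (K + 1)).2 + t ∨
            u.1 * (dir K).1 + u.2 * (dir K).2 + s ≤ X))) := hch
  have h00 := (P 0 0 (by norm_num) (by norm_num) (by norm_num) (by norm_num)).1 (by simpa using hu)
  have hin1 : u + dir (K + 1) ∈ V := by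
    rw [e1, P 0 1 (by norm_num) (by norm_num) (by norm_num) (by norm_num)]
    rcases hm with rfl | rfl | rfl
    · rw [bft_mem_one] at h00 ⊢; omega
    · rw [bft_mem_two] at h00 ⊢; omega
    · rw [bft_mem_three] at h00 ⊢; omega
  -- the type is a quadrant, `k = K + 2`, and `u` is its corner
  have hkK : k = K + 2 ∧ m = 1 ∧ u.1 * (dir K).1 + u.2 * (dir K).2 = X ∧
      u.1 * (dir (K + 1)).1 + u.2 * (dir (K + 1)).2 = Y := by
    have hm0 := P 1 0 (by norm_num) (by norm_num) (by norm_num) (by norm_num)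
    have hm2 := P (-1) 0 (by norm_num) (by norm_num) (by norm_num) (by norm_num)
    have hm3 := P 0 (-1) (by norm_num) (by norm_num) (by norm_num) (by norm_num)
    rw [← e0] at hm0
    rw [← e2] at hm2
    rw [← e3] at hm3
    rcases bft_dir_cases K k with rfl | rfl | rfl | rfl
    · rw [c0 rfl] at hk1; exact absurd hin1 hk1
    · exact absurd hin1 hk
    · rw [c2 rfl] at hk1
      rw [hm2] at hk; rw [hm3] at hk1
      refine ⟨rfl, ?_⟩
      rcases hm with rfl | rfl | rfl
      · rw [bft_mem_one] at h00 hk hk1; exact ⟨rfl, by omega, by omega⟩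
      · rw [bft_mem_two] at h00 hk; omega
      · rw [bft_mem_three] at h00 hk hk1; omega
    · rw [c3 rfl] at hk1
      rw [hm3] at hk; rw [hm0] at hk1
      rcases hm with rfl | rfl | rfl
      · rw [bft_mem_one] at h00 hk1; omega
      · rw [bft_mem_two] at h00 hk1; omega
      · rw [bft_mem_three] at h00 hk hk1; omega
  obtain ⟨rfl, rfl, hal, hpe⟩ := hkK
  obtain ⟨g21, g31, g22, g23⟩ := bft_fin_corner K
  rw [g21, g22, g23]
  -- membership table in the quadrant with corner `u`
  have Q : ∀ s t : ℤ, -2 ≤ s → s ≤ 2 → -2 ≤ t → t ≤ 2 →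
      (u + s • dir K + t • dir (K + 1) ∈ V ↔ 0 ≤ s ∧ 0 ≤ t) := by
    intro s t hs1 hs2 ht1 ht2
    rw [P s t hs1 hs2 ht1 ht2, bft_mem_one]; omega
  have f0 := fun s t => (bft_frame_step K u s t).1
  have f1 := fun s t => (bft_frame_step K u s t).2.1
  have f2 := fun s t => (bft_frame_step K u s t).2.2.1
  have f3 := fun s t => (bft_frame_step K u s t).2.2.2
  -- the entering row neighbour `u + dir (K+1)` = frame `(0, 1)`
  have hA : u + dir (K + 1) = u + (0 : ℤ) • dir K + (1 : ℤ) • dir (K + 1) := e1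
  -- the leaving row neighbour `u + dir K` = frame `(1, 0)`
  have hB : u + dir (K + 0) = u + (1 : ℤ) • dir K + (0 : ℤ) • dir (K + 1) := e0
  have hin : ∀ s t : ℤ, 0 ≤ s → s ≤ 2 → 0 ≤ t → t ≤ 2 → u + s • dir K + t • dir (K + 1) ∈ V :=
    fun s t h1 h2 h3 h4 => (Q s t (by omega) h2 (by omega) h4).2 ⟨h1, h3⟩
  have hout : ∀ s t : ℤ, -2 ≤ s → s ≤ 2 → -2 ≤ t → t ≤ 2 → (s < 0 ∨ t < 0) →
      u + s • dir K + t • dir (K + 1) ∉ V :=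
    fun s t h1 h2 h3 h4 h5 h => by have := (Q s t h1 h2 h3 h4).1 h; omega
  refine ⟨?_, ?_, ?_, ?_, ?_, ?_⟩
  · rw [hA]; exact hin 0 1 le_rfl (by norm_num) (by norm_num) (by norm_num)
  · rw [hA, f2]; exact hout (0 - 1) 1 (by norm_num) (by norm_num) (by norm_num) (by norm_num) (by norm_num)
  · -- `dsucc V (u + dir (K+1), K+2) = (u, K+2)`: straight (second case)
    have h1 : u + dir (K + 1) + dir (K + 2 + 1) ∈ V := by
      rw [g21, hA, f3]; simpa using hu
    have h2 : u + dir (K + 1) + dir (K + 2 + 1) + dir (K + 2) ∉ V := by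
      rw [g21, hA, f3, f2]
      exact hout (0 - 1) (1 - 1) (by norm_num) (by norm_num) (by norm_num) (by norm_num) (by norm_num)
    rw [(rb_dsucc_cases V (u + dir (K + 1)) (K + 2)).2.1 h1 h2, g21, hA, f3]
    simp
  · -- `dsucc V (u, K+3) = (u + dir K, K+3)`: straight (second case)
    have h1 : u + dir (K + 3 + 1) ∈ V := by
      rw [g31, hB]; exact hin 1 0 (by norm_num) (by norm_num) le_rfl (by norm_num)
    have h2 : u + dir (K + 3 + 1) + dir (K + 3) ∉ V := by
      rw [g31, hB, f3]
      exact hout 1 (0 - 1) (by norm_num) (by norm_num) (by norm_num) (by norm_num) (by norm_num)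
    rw [(rb_dsucc_cases V u (K + 3)).2.1 h1 h2, g31]
  · -- neighbour count at `u + dir (K+1)`
    refine rb_card_eq_one_of_unique (k₀ := K + 2) ?_ fun j hj => ?_
    · rw [hA, f2]; exact hout (0 - 1) 1 (by norm_num) (by norm_num) (by norm_num) (by norm_num) (by norm_num)
    · rcases bft_dir_cases K j with rfl | rfl | rfl | rfl
      · rw [hA, f0] at hj; exact absurd (hin (0 + 1) 1 (by norm_num) (by norm_num) (by norm_num) (by norm_num)) hj
      · rw [hA, f1] at hj; exact absurd (hin 0 (1 + 1) le_rfl (by norm_num) (by norm_num) (by norm_num)) hj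
      · rfl
      · rw [hA, f3] at hj; exact absurd (by simpa using hu) hj
  · -- neighbour count at `u + dir K`
    refine rb_card_eq_one_of_unique (k₀ := K + 3) ?_ fun j hj => ?_
    · rw [hB, f3]; exact hout 1 (0 - 1) (by norm_num) (by norm_num) (by norm_num) (by norm_num) (by norm_num)
    · rcases bft_dir_cases K j with rfl | rfl | rfl | rfl
      · rw [hB, f0] at hj; exact absurd (hin (1 + 1) 0 (by norm_num) (by norm_num) le_rfl (by norm_num)) hj
      · rw [hB, f1] at hj; exact absurd (hin 1 (0 + 1) (by norm_num) (by norm_num) (by norm_num) (by norm_num)) hj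
      · rw [hB, f2] at hj; exact absurd (by simpa using hu) hj
      · rfl

end Summit.CriticalPhenomena.CardyFormulaZ2.Cruxes.RectilinearCardy.ExcursionKernelCovariance

end
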